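import Summits.CriticalPhenomena.PercolationContinuityZ3.Theorems.Transplant.HeisenbergPlanarSkeleton
import Summits.CriticalPhenomena.PercolationContinuityZ3.Theorems.TransplantHeisenbergZSlabCritical
import HarnessLib

/-!
# The `a`-slab `{|a| ≤ L}` of the Heisenberg Cayley graph `Cay(H₃(ℤ); a, b)`: connected, quasi-transitive under the abelian
# `{a = 0} = ⟨b, c⟩`, and the free action of `⟨b^N⟩` by left multiplication with quasi-transitive quotient

builds on p205010 (kernel theorem, internal audit signed; external expert review pending) — nothing in this file uses p205010.
Lane `prim-bschramm`, seat `prim-bschramm-p4` (gen 3; class map, memo `P4-GENERAL.md` §11), helper file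
(`--supports stmt-CriticalPhenomena-4575`).  The `H₃(ℤ)` twin of `HeisenbergZSlabA.lean` (p220054), on the carrier
`Literature.Geometry.MetricEmbeddings.cayleyGraph` (`ℤ × ℤ × ℤ`, law `(a,b,c)(a',b',c') = (a+a', b+b', c+c'+ab')`) used by the lane's
`heisSkeleton`.  It is the slab datum for the product criterion `BoxProdSlabQuotient.lean` with `Y = Cay(H₃(ℤ))` (file
`BoxProdHeisenberg.lean`): cylinders `X × heisCyl ℓ` of `X □ H₃` are thick although `heisCyl ℓ` itself is quasi-one-dimensional.

* §1 `heisSlabA L = {|a| ≤ L}`, `heisSlabAGraph L`; §2 connected for `L ≥ 1` (commutator square inside `{0,1} × {b, b+1}`);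
* §3 slab shifts = left translations by `(0, β, γ)` (keep `a`), `heisSlabAGraph_quasiTransitive` (representatives `(a,0,0)`);
* §4 `HBShift N ≅ ℤ` acting by `(a,b,c) ↦ (a, b+Nn, c)` (left multiplication by `b^{Nn}`) on `ℤ³` and on the slab — by automorphisms, freely;
* §5 the shifts commute with it; `hbQuotient_quasiTransitive`.
(`p_c(heisSlabAGraph L) < 1` is NOT automatic here — `c` is not a generator, the slab contains no edge-embedded `ℤ²`; it is proved in
`HeisenbergSlabAPeierls.lean` with the subdivided-grid Peierls lemma.)
[cite: MartineauSevero2019, Cor. 2.2 (hypotheses)] [cite: CheegerKleinerNaor2011, §1.1] [cite: BenjaminiSchramm1996, §2]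
-/

noncomputable section

open MeasureTheory

namespace Summit.CriticalPhenomena.PercolationContinuityZ3.Theorems.Transplant

open Literature.Probability.Percolation Literature.Probability.LatticeModels SimpleGraph
open Literature.Barriers.CriticalPhenomena (IsQuasiTransitive)
open Literature.Geometry.MetricEmbeddings
open Summit.CriticalPhenomena.PercolationContinuityZ3.Theorems.SameP (heisCyl heisCylGraph zero_mem_heisCyl)
open HeisenbergZ (quotIsoOfEquivariant)

/-! ## §1 The `a`-slab -/

/-- The `a`-slab `{|a| ≤ L}` of `H₃(ℤ)` (all `b, c`). [folklore] -/
def heisSlabA (L : ℕ) : Set (ℤ × ℤ × ℤ) := {g | |g.1| ≤ L}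

/-- The induced slab graph. [folklore] -/
abbrev heisSlabAGraph (L : ℕ) : SimpleGraph (heisSlabA L) := cayleyGraph.induce (heisSlabA L)

/-- Membership, unfolded. [folklore] -/
theorem mem_heisSlabA_iff {L : ℕ} {g : ℤ × ℤ × ℤ} : g ∈ heisSlabA L ↔ |g.1| ≤ L := Iff.rfl

/-- `1 ∈ Σ_L`. [folklore] -/
theorem zero_mem_heisSlabA (L : ℕ) : ((0, 0, 0) : ℤ × ℤ × ℤ) ∈ heisSlabA L := by simp [mem_heisSlabA_iff]

/-- `heisCyl ℓ ⊆ Σ_L` for `ℓ ≤ L`. [folklore] -/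
theorem heisCyl_subset_heisSlabA {ℓ L : ℕ} (h : ℓ ≤ L) : heisCyl ℓ ⊆ heisSlabA L := fun _ hg => hg.1.trans (by exact_mod_cast h)

/-- The slab origin. [folklore] -/
abbrev heisSlabAOrigin (L : ℕ) : heisSlabA L := ⟨(0, 0, 0), zero_mem_heisSlabA L⟩

/-- Induced subgraphs of the Heisenberg Cayley graph are locally finite. [folklore] -/
instance cayleyGraph_induce_locallyFinite (s : Set (ℤ × ℤ × ℤ)) : (cayleyGraph.induce s).LocallyFinite := fun x =>
  ((((cayleyGraph).neighborSet x.1).toFinite.preimage Subtype.val_injective.injOn).subset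
    fun y (hy : (cayleyGraph.induce s).Adj x y) => by simpa [SimpleGraph.mem_neighborSet] using hy).fintype

/-! ## §2 Connectivity (`L ≥ 1`) -/

/-- An ambient edge between slab points is a slab edge. [folklore] -/
theorem heisSlabA_adj {L : ℕ} {g h : ℤ × ℤ × ℤ} (hg : g ∈ heisSlabA L) (hh : h ∈ heisSlabA L) (e : cayleyGraph.Adj g h) :
    (heisSlabAGraph L).Adj ⟨g, hg⟩ ⟨h, hh⟩ := e

/-- `(0,b,c) → (0,b,c+1)` inside the slab by the commutator square `a b a⁻¹ b⁻¹` through level `a = 1`. [folklore] -/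
theorem heisSlabA_reach_c_succ {L : ℕ} (hL : 1 ≤ L) (b c : ℤ) :
    (heisSlabAGraph L).Reachable ⟨(0, b, c), by simp [mem_heisSlabA_iff]⟩ ⟨(0, b, c + 1), by simp [mem_heisSlabA_iff]⟩ := by
  have hL' : |(1 : ℤ)| ≤ L := by rw [abs_one]; exact_mod_cast hL
  have m1 : ((1 : ℤ), b, c) ∈ heisSlabA L := hL'
  have m2 : ((1 : ℤ), b + 1, c + 1) ∈ heisSlabA L := hL'
  have m3 : ((0 : ℤ), b + 1, c + 1) ∈ heisSlabA L := by simp [mem_heisSlabA_iff]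
  have r1 : (heisSlabAGraph L).Adj ⟨(0, b, c), by simp [mem_heisSlabA_iff]⟩ ⟨(1, b, c), m1⟩ :=
    heisSlabA_adj _ _ (cayleyGraph_adj_mk_mulA (by ring))
  have r2 : (heisSlabAGraph L).Adj ⟨(1, b, c), m1⟩ ⟨(1, b + 1, c + 1), m2⟩ :=
    heisSlabA_adj _ _ (cayleyGraph_adj_mk_mulB rfl (by ring))
  have r3 : (heisSlabAGraph L).Adj ⟨(0, b + 1, c + 1), m3⟩ ⟨(1, b + 1, c + 1), m2⟩ :=
    heisSlabA_adj _ _ (cayleyGraph_adj_mk_mulA (by ring))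
  have r4 : (heisSlabAGraph L).Adj ⟨(0, b, c + 1), by simp [mem_heisSlabA_iff]⟩ ⟨(0, b + 1, c + 1), m3⟩ :=
    heisSlabA_adj _ _ (cayleyGraph_adj_mk_mulB rfl (by ring))
  exact ((r1.reachable.trans r2.reachable).trans r3.symm.reachable).trans r4.symm.reachable

/-- `(0,b,0) → (0,b,c)` inside the slab. [folklore] -/
theorem heisSlabA_reach_c {L : ℕ} (hL : 1 ≤ L) (b : ℤ) : ∀ c : ℤ,
    (heisSlabAGraph L).Reachable ⟨(0, b, 0), by simp [mem_heisSlabA_iff]⟩ ⟨(0, b, c), by simp [mem_heisSlabA_iff]⟩ := by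
  intro c
  induction c using Int.induction_on with
  | zero => exact Reachable.refl _
  | succ n ih => exact ih.trans (heisSlabA_reach_c_succ hL b n)
  | pred n ih =>
    have h := heisSlabA_reach_c_succ hL b (-(n : ℤ) - 1)
    rw [show (-(n : ℤ) - 1 + 1) = -(n : ℤ) by ring] at h
    exact ih.trans h.symm

/-- `(0,0,0) → (0,b,0)` inside the slab (`b`-steps at level `a = 0` do not shear `c`). [folklore] -/
theorem heisSlabA_reach_b {L : ℕ} : ∀ b : ℤ,
    (heisSlabAGraph L).Reachable (heisSlabAOrigin L) ⟨(0, b, 0), by simp [mem_heisSlabA_iff]⟩ := by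
  intro b
  induction b using Int.induction_on with
  | zero => exact Reachable.refl _
  | succ n ih =>
    exact ih.trans (heisSlabA_adj _ _ (cayleyGraph_adj_mk_mulB (y := (n : ℤ)) rfl (by ring))).reachable
  | pred n ih =>
    have h : (heisSlabAGraph L).Adj ⟨(0, -(n : ℤ) - 1, 0), by simp [mem_heisSlabA_iff]⟩ ⟨(0, -(n : ℤ), 0), by simp [mem_heisSlabA_iff]⟩ :=
      heisSlabA_adj _ _ (cayleyGraph_adj_mk_mulB (by ring) (by ring))
    exact ih.trans h.symm.reachable

/-- `(0,b,c) → (a,b,c)` inside the slab for `|a| ≤ L` (`a`-steps keep `b, c`). [folklore] -/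
theorem heisSlabA_reach_a {L : ℕ} (b c : ℤ) : ∀ a : ℤ, (ha : |a| ≤ L) →
    (heisSlabAGraph L).Reachable ⟨(0, b, c), by simp [mem_heisSlabA_iff]⟩ ⟨(a, b, c), ha⟩ := by
  intro a
  induction a using Int.induction_on with
  | zero => intro _; exact Reachable.refl _
  | succ n ih =>
    intro ha
    have hn : |(n : ℤ)| ≤ L := by rw [abs_le] at ha ⊢; constructor <;> linarith
    exact (ih hn).trans (heisSlabA_adj hn ha (cayleyGraph_adj_mk_mulA rfl)).reachable
  | pred n ih =>
    intro ha
    have hn : |(-(n : ℤ))| ≤ L := by rw [abs_le] at ha ⊢; constructor <;> linarith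
    have h : (heisSlabAGraph L).Adj ⟨(-(n : ℤ) - 1, b, c), ha⟩ ⟨(-(n : ℤ), b, c), hn⟩ :=
      heisSlabA_adj ha hn (cayleyGraph_adj_mk_mulA (by ring))
    exact (ih hn).trans h.symm.reachable

/-- Every slab vertex is joined to `1` inside the slab (`L ≥ 1`). [folklore] -/
theorem heisSlabA_reach_all {L : ℕ} (hL : 1 ≤ L) (x : heisSlabA L) : (heisSlabAGraph L).Reachable (heisSlabAOrigin L) x := by
  obtain ⟨⟨a, b, c⟩, hx⟩ := x
  exact ((heisSlabA_reach_b b).trans (heisSlabA_reach_c hL b c)).trans (heisSlabA_reach_a b c a hx)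

/-- **The slab graph is connected** (`L ≥ 1`). [folklore] -/
theorem heisSlabAGraph_connected {L : ℕ} (hL : 1 ≤ L) : (heisSlabAGraph L).Connected :=
  { preconnected := fun u v => ((heisSlabA_reach_all hL u).symm).trans (heisSlabA_reach_all hL v)
    nonempty := ⟨heisSlabAOrigin L⟩ }

/-! ## §3 Slab shifts: left translations by `{a = 0} = ⟨b, c⟩` (abelian); quasi-transitivity -/

/-- Left translation by `(0,β,γ)`: `(a,b,c) ↦ (a, b+β, c+γ)`. [folklore] -/
theorem heisMul_a0 (β γ : ℤ) (g : ℤ × ℤ × ℤ) : heisMul (0, β, γ) g = (g.1, g.2.1 + β, g.2.2 + γ) := by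
  obtain ⟨a, b, c⟩ := g
  simp only [heisMul, Prod.mk.injEq]
  exact ⟨by ring, by ring, by ring⟩

/-- It preserves the slab. [folklore] -/
theorem heisMul_a0_mem_heisSlabA {L : ℕ} (β γ : ℤ) {g : ℤ × ℤ × ℤ} : heisMul (0, β, γ) g ∈ heisSlabA L ↔ g ∈ heisSlabA L := by
  rw [mem_heisSlabA_iff, mem_heisSlabA_iff, heisMul_a0]

/-- Left translation by `(0,β,γ)` maps the slab bijectively onto itself. [folklore] -/
theorem heisLeftIso_a0_bijOn (L : ℕ) (β γ : ℤ) : Set.BijOn (heisLeftIso (0, β, γ)) (heisSlabA L) (heisSlabA L) := by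
  refine Set.BijOn.mk (fun x hx => ?_) (heisLeftIso (0, β, γ)).injective.injOn (fun y hy => ?_)
  · rw [heisLeftIso_apply]; exact (heisMul_a0_mem_heisSlabA β γ).2 hx
  · refine ⟨heisMul (0, -β, -γ) y, (heisMul_a0_mem_heisSlabA (-β) (-γ)).2 hy, ?_⟩
    rw [heisLeftIso_apply, heisMul_a0, heisMul_a0]
    obtain ⟨a, b, c⟩ := y
    simp

/-- **The slab shift** by `(0,β,γ)` as an automorphism of the slab graph. [folklore] -/
def heisSlabShift (L : ℕ) (β γ : ℤ) : heisSlabAGraph L ≃g heisSlabAGraph L :=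
  (heisLeftIso (0, β, γ)).induce (heisLeftIso_a0_bijOn L β γ)

/-- The shift on the underlying vertex. [folklore] -/
@[simp] theorem heisSlabShift_apply_val (L : ℕ) (β γ : ℤ) (v : heisSlabA L) :
    ((heisSlabShift L β γ v : heisSlabA L) : ℤ × ℤ × ℤ) = heisMul (0, β, γ) v := rfl

/-- The `2L+1` orbit representatives `(a,0,0)`. [folklore] -/
def heisSlabAReps (L : ℕ) : Finset (ℤ × ℤ × ℤ) := (Finset.Icc (-(L : ℤ)) L).image fun a => (a, 0, 0)

/-- The shift by `(0, -b, -c)` brings `(a,b,c)` to the representative `(a,0,0)`. [folklore] -/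
theorem heisSlabShift_mem_reps (L : ℕ) (v : heisSlabA L) :
    ((heisSlabShift L (-(v : ℤ × ℤ × ℤ).2.1) (-(v : ℤ × ℤ × ℤ).2.2) v : heisSlabA L) : ℤ × ℤ × ℤ) ∈ heisSlabAReps L := by
  rw [heisSlabShift_apply_val, heisMul_a0, heisSlabAReps, Finset.mem_image]
  refine ⟨(v : ℤ × ℤ × ℤ).1, ?_, ?_⟩
  · have hv : |(v : ℤ × ℤ × ℤ).1| ≤ L := v.2
    rw [abs_le] at hv
    exact Finset.mem_Icc.2 ⟨hv.1, hv.2⟩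
  · simp

/-- **The slab graph is quasi-transitive.** [folklore] -/
theorem heisSlabAGraph_quasiTransitive (L : ℕ) : IsQuasiTransitive (heisSlabAGraph L) := by
  classical
  refine ⟨(heisSlabAReps L).subtype (· ∈ heisSlabA L), fun v =>
    ⟨heisSlabShift L (-(v : ℤ × ℤ × ℤ).2.1) (-(v : ℤ × ℤ × ℤ).2.2), ?_⟩⟩
  rw [Finset.mem_subtype]
  exact heisSlabShift_mem_reps L v

/-! ## §4 The free action of `⟨b^N⟩` by left multiplication -/

/-- `⟨b^N⟩ ≅ ℤ` (type synonym of `Multiplicative ℤ`). [folklore] -/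
def HBShift (_N : ℕ) : Type := Multiplicative ℤ

/-- group structure. [folklore] -/
instance (N : ℕ) : Group (HBShift N) := inferInstanceAs (Group (Multiplicative ℤ))
/-- non-trivial. [folklore] -/
instance (N : ℕ) : Nontrivial (HBShift N) := inferInstanceAs (Nontrivial (Multiplicative ℤ))

/-- The exponent. [folklore] -/
def HBShift.exp {N : ℕ} (g : HBShift N) : ℤ := Multiplicative.toAdd (show Multiplicative ℤ from g)

/-- `exp 1 = 0`. [folklore] -/
@[simp] theorem HBShift.exp_one {N : ℕ} : (1 : HBShift N).exp = 0 := rfl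
/-- `exp (g h) = exp g + exp h`. [folklore] -/
@[simp] theorem HBShift.exp_mul {N : ℕ} (g h : HBShift N) : (g * h).exp = g.exp + h.exp := rfl
/-- `exp` is injective. [folklore] -/
theorem HBShift.exp_injective {N : ℕ} : Function.Injective (HBShift.exp (N := N)) :=
  fun _ _ h => Multiplicative.toAdd.injective h

/-- `b^{Nn} · (a,b,c) = (a, b + Nn, c)`. [folklore] -/
instance (N : ℕ) : MulAction (HBShift N) (ℤ × ℤ × ℤ) where
  smul g x := (x.1, x.2.1 + N * g.exp, x.2.2)
  one_smul x := by
    show ((x.1, x.2.1 + N * (1 : HBShift N).exp, x.2.2) : ℤ × ℤ × ℤ) = x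
    obtain ⟨a, b, c⟩ := x
    simp
  mul_smul g h x := by
    show ((x.1, x.2.1 + N * (g * h).exp, x.2.2) : ℤ × ℤ × ℤ) = (x.1, (x.2.1 + N * h.exp) + N * g.exp, x.2.2)
    simp only [HBShift.exp_mul, Prod.mk.injEq, true_and, and_true]
    ring

/-- The action, unfolded. [folklore] -/
theorem HBShift.smul_def {N : ℕ} (g : HBShift N) (x : ℤ × ℤ × ℤ) : g • x = (x.1, x.2.1 + N * g.exp, x.2.2) := rfl

/-- The action is left multiplication by `(0, Nn, 0)`. [folklore] -/
theorem HBShift.smul_eq_heisMul {N : ℕ} (g : HBShift N) (x : ℤ × ℤ × ℤ) : g • x = heisMul (0, N * g.exp, 0) x := by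
  rw [HBShift.smul_def, heisMul_a0]
  simp

/-- It preserves the slab. [folklore] -/
theorem HBShift.smul_mem_heisSlabA {N L : ℕ} (g : HBShift N) {x : ℤ × ℤ × ℤ} : g • x ∈ heisSlabA L ↔ x ∈ heisSlabA L := by
  rw [HBShift.smul_eq_heisMul]; exact heisMul_a0_mem_heisSlabA _ _

/-- The induced action on the slab. [folklore] -/
instance (N L : ℕ) : MulAction (HBShift N) (heisSlabA L) where
  smul g x := ⟨g • (x : ℤ × ℤ × ℤ), (HBShift.smul_mem_heisSlabA g).2 x.2⟩
  one_smul x := Subtype.ext (one_smul (HBShift N) (x : ℤ × ℤ × ℤ))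
  mul_smul g h x := Subtype.ext (mul_smul g h (x : ℤ × ℤ × ℤ))

/-- The slab action on the underlying vertex. [folklore] -/
@[simp] theorem HBShift.coe_smul {N L : ℕ} (g : HBShift N) (x : heisSlabA L) :
    ((g • x : heisSlabA L) : ℤ × ℤ × ℤ) = g • (x : ℤ × ℤ × ℤ) := rfl

/-- The action on the slab is by automorphisms. [folklore] -/
theorem hbShift_isActionByAut (N L : ℕ) : IsActionByAut (heisSlabAGraph L) (HBShift N) := by
  intro g x y
  show cayleyGraph.Adj ((g • x : heisSlabA L) : ℤ × ℤ × ℤ) ((g • y : heisSlabA L) : ℤ × ℤ × ℤ) ↔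
    cayleyGraph.Adj (x : ℤ × ℤ × ℤ) (y : ℤ × ℤ × ℤ)
  rw [HBShift.coe_smul, HBShift.coe_smul, HBShift.smul_eq_heisMul, HBShift.smul_eq_heisMul]
  exact (heisLeftIso _).map_rel_iff'

/-- The action on the slab is free (`N ≠ 0`). [folklore] -/
theorem hbShift_free {N L : ℕ} (hN : N ≠ 0) (g : HBShift N) (x : heisSlabA L) (h : g • x = x) : g = 1 := by
  have h1 := congrArg (fun v : heisSlabA L => (v : ℤ × ℤ × ℤ).2.1) h
  simp only [HBShift.coe_smul, HBShift.smul_def] at h1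
  have : (N : ℤ) * g.exp = 0 := by linarith
  have hexp : g.exp = 0 := by
    rcases mul_eq_zero.1 this with h | h
    · exact absurd (by exact_mod_cast h) hN
    · exact h
  exact HBShift.exp_injective (by simpa using hexp)

/-! ## §5 The quotient is quasi-transitive -/

/-- The slab shifts commute with the action. [folklore] -/
theorem heisSlabShift_smul {N L : ℕ} (β γ : ℤ) (g : HBShift N) (x : heisSlabA L) :
    heisSlabShift L β γ (g • x) = g • heisSlabShift L β γ x := by
  apply Subtype.ext
  rw [HBShift.coe_smul, heisSlabShift_apply_val, heisSlabShift_apply_val, HBShift.coe_smul, HBShift.smul_def, HBShift.smul_def,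
    heisMul_a0, heisMul_a0]
  simp only [Prod.mk.injEq, true_and, and_true]
  ring

/-- **The quotient `⟨b^N⟩ \ Σ_L` is quasi-transitive** (the shifts descend). [folklore] -/
theorem hbQuotient_quasiTransitive (N L : ℕ) : IsQuasiTransitive (orbitQuotientGraph (heisSlabAGraph L) (HBShift N)) := by
  classical
  refine ⟨((heisSlabAReps L).subtype (· ∈ heisSlabA L)).image (qmk (HBShift N)), fun u => ?_⟩
  induction u using Quotient.inductionOn' with
  | h v =>
  refine ⟨quotIsoOfEquivariant (hbShift_isActionByAut N L) (heisSlabShift L (-(v : ℤ × ℤ × ℤ).2.1) (-(v : ℤ × ℤ × ℤ).2.2))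
    (fun g x => heisSlabShift_smul _ _ g x), ?_⟩
  show qmk (HBShift N) (heisSlabShift L (-(v : ℤ × ℤ × ℤ).2.1) (-(v : ℤ × ℤ × ℤ).2.2) v) ∈
    ((heisSlabAReps L).subtype (· ∈ heisSlabA L)).image (qmk (HBShift N))
  exact Finset.mem_image_of_mem _ (Finset.mem_subtype.2 (heisSlabShift_mem_reps L v))

/-! ## §6 The cylinder `heisCyl ℓ` against the action (`N ≥ 2ℓ + 2`) -/

/-- `|N·n| < N` forces `g = 1`. [folklore] -/
theorem HBShift.eq_one_of_abs_lt {N : ℕ} (g : HBShift N) (h : |(N : ℤ) * g.exp| < N) : g = 1 := by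
  have hexp : g.exp = 0 := by
    by_contra hne
    have h1le : 1 ≤ |g.exp| := Int.one_le_abs hne
    have : (N : ℤ) ≤ |(N : ℤ) * g.exp| := by
      rw [abs_mul, Nat.abs_cast]
      exact le_mul_of_one_le_right (by positivity) h1le
    linarith
  exact HBShift.exp_injective (by simpa using hexp)

/-- (i) for the cylinder: a translate of a cylinder point in the cylinder is the trivial translate (`N > 2ℓ`). [folklore] -/
theorem eq_one_of_smul_mem_heisCyl {ℓ L N : ℕ} (hN : 2 * ℓ < N) {g : HBShift N} {x : heisSlabA L}
    (hx : (x : ℤ × ℤ × ℤ) ∈ heisCyl ℓ) (hgx : ((g • x : heisSlabA L) : ℤ × ℤ × ℤ) ∈ heisCyl ℓ) : g = 1 := by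
  apply HBShift.eq_one_of_abs_lt
  have h1 : |(x : ℤ × ℤ × ℤ).2.1| ≤ ℓ := hx.2
  have h2 : |(x : ℤ × ℤ × ℤ).2.1 + N * g.exp| ≤ ℓ := by
    have := hgx.2
    rw [HBShift.coe_smul, HBShift.smul_def] at this
    simpa using this
  have hN' : (2 * ℓ : ℤ) < N := by exact_mod_cast hN
  rw [abs_le] at h1 h2
  rw [abs_lt]
  constructor <;> linarith [h1.1, h1.2, h2.1, h2.2]

/-- Across an edge of `H₃(ℤ)` the `b`-coordinate changes by at most one. [cite: CheegerKleinerNaor2011, §1.1] -/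
theorem abs_b_sub_le_one {g h : ℤ × ℤ × ℤ} (e : cayleyGraph.Adj g h) : |g.2.1 - h.2.1| ≤ 1 := by
  have := abs_heisAb_sub_le_one e 1
  simpa [SameP.heisAb_apply_one] using this

/-- (ii) for the cylinder: no slab edge joins a cylinder point to a non-trivial translate of a cylinder point (`N > 2ℓ + 1`).
[folklore] -/
theorem eq_one_of_adj_smul_heisCyl {ℓ L N : ℕ} (hN : 2 * ℓ + 1 < N) {g : HBShift N} {x y : heisSlabA L}
    (hx : (x : ℤ × ℤ × ℤ) ∈ heisCyl ℓ) (hy : (y : ℤ × ℤ × ℤ) ∈ heisCyl ℓ) (h : (heisSlabAGraph L).Adj x (g • y)) : g = 1 := by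
  apply HBShift.eq_one_of_abs_lt
  have hadj : cayleyGraph.Adj (x : ℤ × ℤ × ℤ) ((g • y : heisSlabA L) : ℤ × ℤ × ℤ) := h
  have hb := abs_b_sub_le_one hadj
  rw [HBShift.coe_smul, HBShift.smul_def] at hb
  simp only at hb
  have h1 : |(x : ℤ × ℤ × ℤ).2.1| ≤ ℓ := hx.2
  have h2 : |(y : ℤ × ℤ × ℤ).2.1| ≤ ℓ := hy.2
  have hN' : (2 * ℓ + 1 : ℤ) < N := by exact_mod_cast hN
  rw [abs_le] at h1 h2 hb
  rw [abs_lt]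
  constructor <;> linarith [h1.1, h1.2, h2.1, h2.2, hb.1, hb.2]

end Summit.CriticalPhenomena.PercolationContinuityZ3.Theorems.Transplant

end
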